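import Mathlib
import Summits.Ventures.HodgeRepro0.P8K3LatticeADefs
import Summits.Ventures.HodgeRepro0.P8K3LatticeA5
import Summits.Ventures.HodgeRepro0.P8K3LatticeA6

/-!
# P8K3LatticeAIso (seat p8) — the discriminant form of the family-(A) lattice has no non-zero isotropic element

With `w₁, w₂` the columns of `W` (the columns of `Q` at the two non-unit diagonal positions), `G * (w_i/6)` is integral (`GW` has all
entries divisible by 6 — visible in `P8K3LatticeADefs`), so `w₁/6, w₂/6 ∈ L^*` and their classes generate `L^*/L ≅ (ℤ/6)²` (the other columns
of `Q` span `L` modulo these). The discriminant form is `q(a w₁/6 + b w₂/6) = (g₁₁ a² + 2 g₁₂ a b + g₂₂ b²)/36 ∈ ℚ/2ℤ` with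
`(g_ij) = Wᵀ G W = Gram2`; it vanishes iff `36 · 2` divides the integer numerator. The theorem below checks all 35 non-zero `(a, b)`.
-/

namespace HodgeRepro0.P8K3LatticeA

/-- The integer quadratic form `(a w₁ + b w₂)ᵀ G (a w₁ + b w₂)` in terms of `Gram2`. -/
def N (a b : ℤ) : ℤ := Gram2 0 0 * a * a + 2 * Gram2 0 1 * a * b + Gram2 1 1 * b * b

/-- `Gram2 = Wᵀ * G * W`. -/
theorem Gram2_eq : Gram2 = W.transpose * G * W := by
  rw [← Wt_eq, Matrix.mul_assoc, G_mul_W, Wt_mul_GW]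

/-- No non-zero element of the discriminant group `(ℤ/6)²` is isotropic: `N a b ≢ 0 (mod 72)` for all `(a, b) ≠ (0, 0)` with
`0 ≤ a, b < 6`. -/
theorem no_isotropic : ∀ a b : Fin 6, (a ≠ 0 ∨ b ≠ 0) → N (a : ℤ) (b : ℤ) % 72 ≠ 0 := by
  decide

end HodgeRepro0.P8K3LatticeA
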